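import Mathlib
import HarnessLib
import Literature.Analysis.FluidPDE.Tao2016AveragedNS.TaylorChainCertificate
import Summits.NavierStokesRegularity.NavierStokesRegularity.Theorems.TaylorModelRungThreeReadoutChainStep
import Summits.NavierStokesRegularity.NavierStokesRegularity.Theorems.TaylorModelRungThreeReadoutChainMajorant

/-!
# Line `taylor-model` on crux K1b-DR (stmt-NavierStokesRegularity-23954) — stub G1 (`ChainEnclosureHolds`),
# helper 3: the node step at the certificate's levels `E` (general entry state) and `EI` (base trajectory)

The generic Lohner node step (`node_step`, `inStep_bound`, level `(f, ε)`) specialised to the two levels the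
chain enclosure C1–C3 needs: the NODE PREDICATES `NodeE cd j s y` (`y = x j s + Cm j s ξ + e` on the window,
`|ξ| ≤ rP j s`, `e ∈ Ball(E j s)`) and `NodeI cd j s y` (`y = x j s + e` on the window, `e ∈ Ball(EI j s)`) are
carried node to node by any flow package (`nodeE_step`, `nodeI_step`: step inequalities `E`/`EI` of `Chain`),
with the in-step enclosures `TP j s u + Ball(Sp j s)` / `Ball(SpI j s)` (monotonicity of the three majorants in
`u`, `inStep_radius_le`, and the `Sp`/`SpI` clauses of `Chain`). Also: the base nodes `nodeE_zero` (entry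
decomposition of `Chain`) and `nodeI_zero`, and the window ball `mC + ρO` containing every node state
(`NodeE.inBall`). (Mesh facts `Tn_mono`, `Tn_nonneg`, `valid_Tn_succ` are reused from the G2 helper file
`…ReadoutG2Sigma`.)

MODEL-lattice bookkeeping only (rung TL-M3); nothing here is a statement about the Navier–Stokes equations.
-/

noncomputable section

-- the sub-problem namespace repeats the summit name by design (D-0017)
set_option linter.dupNamespace false

namespace Summit.NavierStokesRegularity.NavierStokesRegularity.Theorems.TaylorModelReadout

open scoped BigOperators
open Set Finset Literature.Analysis.FluidPDE.TaoCascade Literature.Analysis.FluidPDE.TaoCascade.TaylorChain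

variable {cd : CertData} {φ : Flow}

/-! ### Node predicates -/

/-- Node predicate at level `E`: `y = x j s + Cm j s ξ + e` on the window, `|ξ| ≤ rP j s`, `e ∈ Ball(E j s)`. [folklore] -/
def NodeE (cd : CertData) (j s : ℕ) (y : Fin 4 → ℤ → ℝ) : Prop :=
  ∃ ξ e : Fin 4 → ℤ → ℝ, (∀ i k, -cd.Kb ≤ k → k ≤ cd.Ka → |ξ i k| ≤ cd.rP j s i k ∧
    y i k = cd.x j s i k + cd.Cm j s ξ i k + e i k) ∧ cd.InBall j e (cd.E j s)

/-- Node predicate at level `EI` (base trajectory, no frame part): `y = x j s + e` on the window,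
`e ∈ Ball(EI j s)`. [folklore] -/
def NodeI (cd : CertData) (j s : ℕ) (y : Fin 4 → ℤ → ℝ) : Prop :=
  ∃ e : Fin 4 → ℤ → ℝ, (∀ i k, -cd.Kb ≤ k → k ≤ cd.Ka → y i k = cd.x j s i k + e i k) ∧ cd.InBall j e (cd.EI j s)

/-- `NodeE` only sees window components. [folklore] -/
theorem NodeE.congr {j s : ℕ} {y y' : Fin 4 → ℤ → ℝ} (h : NodeE cd j s y)
    (hyy : ∀ i k, -cd.Kb ≤ k → k ≤ cd.Ka → y i k = y' i k) : NodeE cd j s y' := by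
  obtain ⟨ξ, e, hd, he⟩ := h
  exact ⟨ξ, e, fun i k h1 h2 => ⟨(hd i k h1 h2).1, (hyy i k h1 h2) ▸ (hd i k h1 h2).2⟩, he⟩

/-- `NodeI` only sees window components. [folklore] -/
theorem NodeI.congr {j s : ℕ} {y y' : Fin 4 → ℤ → ℝ} (h : NodeI cd j s y)
    (hyy : ∀ i k, -cd.Kb ≤ k → k ≤ cd.Ka → y i k = y' i k) : NodeI cd j s y' := by
  obtain ⟨e, hd, he⟩ := h
  exact ⟨e, fun i k h1 h2 => (hyy i k h1 h2) ▸ hd i k h1 h2, he⟩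

/-- A level-`EI` node is a level-`E` node with zero frame coordinates, and its error is in both balls. [folklore] -/
theorem NodeI.decomp (hV : cd.Valid) {j : ℕ} (hj : j ≤ cd.N₀) {s : ℕ} (hs : s ≤ cd.S j) {y : Fin 4 → ℤ → ℝ}
    (h : NodeI cd j s y) :
    ∃ ξ e : Fin 4 → ℤ → ℝ, (∀ i k, -cd.Kb ≤ k → k ≤ cd.Ka → |ξ i k| ≤ cd.rP j s i k ∧
      y i k = cd.x j s i k + cd.Cm j s ξ i k + e i k) ∧ cd.InBall j e (cd.E j s) ∧ cd.InBall j e (cd.EI j s) := by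
  obtain ⟨e, hd, he⟩ := h
  obtain ⟨-, hN, hC, -⟩ := hV
  have hω : ∀ k, 0 < cd.ω j k := (hN.1 j hj).2.2.2.2.2.2.1
  obtain ⟨-, -, -, -, -, -, hA, -⟩ := hC j hj
  obtain ⟨-, -, -, -, a5, -, a7, -, -, -, -, a12, -⟩ := hA s hs
  refine ⟨0, e, fun i k h1 h2 => ⟨?_, ?_⟩, inBall_mono hω he a7, he⟩
  · simp only [Pi.zero_apply, abs_zero]; exact a5 i k
  · simp only [a12.map_zero, Pi.zero_apply, add_zero]; exact hd i k h1 h2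

/-- A level-`EI` node is a level-`E` node. [folklore] -/
theorem NodeI.nodeE (hV : cd.Valid) {j : ℕ} (hj : j ≤ cd.N₀) {s : ℕ} (hs : s ≤ cd.S j) {y : Fin 4 → ℤ → ℝ}
    (h : NodeI cd j s y) : NodeE cd j s y := by
  obtain ⟨ξ, e, hd, he, -⟩ := h.decomp hV hj hs
  exact ⟨ξ, e, hd, he⟩

/-- Every level-`E` node state lies in the window ball of radius `mC j s + ρO j s`. [folklore] -/
theorem NodeE.inBall (hV : cd.Valid) {j : ℕ} (hj : j ≤ cd.N₀) {s : ℕ} (hs : s ≤ cd.S j) {y : Fin 4 → ℤ → ℝ}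
    (h : NodeE cd j s y) : cd.InBall j y (cd.mC j s + cd.ρO j s) := by
  obtain ⟨ξ, e, hd, he⟩ := h
  obtain ⟨-, hN, hC, -⟩ := hV
  have hω : ∀ k, 0 < cd.ω j k := (hN.1 j hj).2.2.2.2.2.2.1
  obtain ⟨-, -, -, -, -, -, hA, -⟩ := hC j hj
  obtain ⟨-, -, -, a4, -, -, -, -, -, -, a11, -, -, -, a15, -⟩ := hA s hs
  have hξ : ∀ i k, -cd.Kb ≤ k → k ≤ cd.Ka → |ξ i k| ≤ cd.rP j s i k := fun i k h1 h2 => (hd i k h1 h2).1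
  have h1 : cd.InBall j (cd.x j s + cd.Cm j s ξ + e) (cd.mC j s + (cd.ρ j s - cd.E j s) + cd.E j s) :=
    inBall_add (inBall_add a4 (a15 ξ hξ).1) he
  have h2 : cd.InBall j (cd.x j s + cd.Cm j s ξ + e) (cd.mC j s + cd.ρO j s) :=
    inBall_mono hω h1 (by linarith)
  intro i k hk1 hk2
  rw [(hd i k hk1 hk2).2]
  exact h2 i k hk1 hk2

/-- The entry state `q` of the polytope is a level-`E` node at `s = 0` (entry decomposition of `Chain`). [folklore] -/
theorem nodeE_zero (hV : cd.Valid) {j : ℕ} (hj : j ≤ cd.N₀) {q : Fin 4 → ℤ → ℝ} (hq : InPoly cd j q) :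
    NodeE cd j 0 q := by
  obtain ⟨ξ, e, hd, he, -⟩ := (hV.2.2.1 j hj).2.2.2.2.2.1 q hq
  exact ⟨ξ, e, hd, he⟩

/-- The centre `x j 0` is a level-`EI` node at `s = 0` (`EI j 0 = 0`). [folklore] -/
theorem nodeI_zero (hV : cd.Valid) {j : ℕ} (hj : j ≤ cd.N₀) : NodeI cd j 0 (cd.x j 0) := by
  refine ⟨0, fun i k _ _ => by simp, ?_⟩
  rw [(hV.2.2.1 j hj).2.2.2.1]
  exact inBall_zero j

/-! ### In-step radius: monotone in `u` -/

/-- The in-step radius at time `u ≤ h j s` is at most its value at `h j s` (level `r ≤ ρO j s`). [folklore] -/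
theorem inStep_radius_le (hV : cd.Valid) {j : ℕ} (hj : j ≤ cd.N₀) {s : ℕ} (hs : s < cd.S j) {r : ℝ}
    (hr0 : 0 ≤ r) (hr : r ≤ cd.ρO j s) {u : ℝ} (hu : u ∈ Icc 0 (cd.h j s)) :
    cd.NV j s * r + cd.Rem (cd.bb j) (cd.mC j s) u + cd.RemV (cd.bb j) (cd.mC j s) u * r +
        CertData.Dev (cd.bb j) (cd.mC j s) r u ≤
      cd.NV j s * r + cd.Rem (cd.bb j) (cd.mC j s) (cd.h j s) + cd.RemV (cd.bb j) (cd.mC j s) (cd.h j s) * r +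
        CertData.Dev (cd.bb j) (cd.mC j s) r (cd.h j s) := by
  obtain ⟨-, hN, hC, -⟩ := hV
  have hbb : 0 ≤ cd.bb j := (hN.2 j hj).1
  obtain ⟨-, -, -, -, -, -, hA, hB⟩ := hC j hj
  obtain ⟨-, -, a3, -⟩ := hA s hs.le
  obtain ⟨b1, b2, b3, -⟩ := hB s hs
  have hg : cd.bb j * (cd.mC j s + r) * cd.h j s < 1 := by
    have h1 : cd.bb j * (cd.mC j s + r) * cd.h j s ≤ cd.bb j * (cd.mC j s + cd.ρO j s) * cd.h j s := by
      have : 0 ≤ cd.bb j * cd.h j s := mul_nonneg hbb b1.le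
      nlinarith
    exact lt_of_le_of_lt h1 b3
  have h1 := Rem_mono (cd := cd) hbb a3 hu.1 hu.2 b2
  have h2 := RemV_mono (cd := cd) hbb a3 hu.1 hu.2 b2
  have h3 := Dev_mono hbb a3 hr0 hu.1 hu.2 hg
  have h4 : cd.RemV (cd.bb j) (cd.mC j s) u * r ≤ cd.RemV (cd.bb j) (cd.mC j s) (cd.h j s) * r :=
    mul_le_mul_of_nonneg_right h2 hr0
  linarith

/-! ### The node step at level `E` -/

/-- **Node step, level `E`**, with the in-step enclosure `TP j s u + Ball(Sp j s)`.
[cite: Zgliczynski2002C1Lohner, §3–4] -/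
theorem nodeE_step (hF : IsFlowPackage cd φ) (hV : cd.Valid) {j : ℕ} (hj : j ≤ cd.N₀) {s : ℕ} (hs : s < cd.S j)
    {y : Fin 4 → ℤ → ℝ} (hy : NodeE cd j s y) :
    NodeE cd j (s + 1) (stAt φ j y (cd.h j s)) ∧
      ∀ u ∈ Icc 0 (cd.h j s), cd.InBall j (stAt φ j y u - cd.TP j s u) (cd.Sp j s) := by
  obtain ⟨ξ, e, hdec, he⟩ := hy
  have hV' := hV
  obtain ⟨-, hN, hC, -⟩ := hV'
  have hω : ∀ k, 0 < cd.ω j k := (hN.1 j hj).2.2.2.2.2.2.1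
  obtain ⟨-, -, -, -, -, -, hA, hB⟩ := hC j hj
  obtain ⟨-, -, -, -, -, a6, a7, -, -, a10, a11, -, -, -, a15, -⟩ := hA s hs.le
  obtain ⟨-, -, -, -, -, -, -, -, -, -, -, -, -, -, b15, -, -, b18, -⟩ := hB s hs
  have hξ : ∀ i k, -cd.Kb ≤ k → k ≤ cd.Ka → |ξ i k| ≤ cd.rP j s i k := fun i k h1 h2 => (hdec i k h1 h2).1
  have hyd : ∀ i k, -cd.Kb ≤ k → k ≤ cd.Ka → y i k = cd.x j s i k + cd.Cm j s ξ i k + e i k :=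
    fun i k h1 h2 => (hdec i k h1 h2).2
  have hf : 0 ≤ cd.ρ j s - cd.E j s := sub_nonneg.2 a10
  have hε : 0 ≤ cd.E j s := a6.trans a7
  have hρE : cd.ρ j s - cd.E j s + cd.E j s = cd.ρ j s := sub_add_cancel _ _
  have hfe : cd.ρ j s - cd.E j s + cd.E j s ≤ cd.ρO j s := by rw [hρE]; exact a11
  have hCmξ : cd.InBall j (cd.Cm j s ξ) (cd.ρ j s - cd.E j s) := (a15 ξ hξ).1
  refine ⟨?_, fun u hu => ?_⟩
  · obtain ⟨hξ', he'⟩ := node_step hF hV hj hs hf hε hfe hξ hCmξ he hyd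
    rw [hρE] at he'
    refine ⟨cd.Ci j (s + 1) (cd.Vap j s (cd.h j s) (cd.Cm j s ξ)),
      stAt φ j y (cd.h j s) - cd.x j (s + 1) - cd.Cm j (s + 1) (cd.Ci j (s + 1) (cd.Vap j s (cd.h j s) (cd.Cm j s ξ))),
      fun i k h1 h2 => ⟨hξ' i k h1 h2, ?_⟩, inBall_mono hω he' b18⟩
    simp only [Pi.sub_apply]
    ring
  · have h1 := inStep_bound hF hV hj hs hf hε hfe hCmξ he hyd hu
    rw [hρE] at h1
    exact inBall_mono hω h1 ((inStep_radius_le hV hj hs (hε.trans a10) a11 hu).trans b15)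

/-! ### The node step at level `EI` (base trajectory) -/

/-- **Node step, level `EI`** (frame part zero throughout), with the in-step enclosure `TP j s u + Ball(SpI j s)`.
[cite: Zgliczynski2002C1Lohner, §3–4] -/
theorem nodeI_step (hF : IsFlowPackage cd φ) (hV : cd.Valid) {j : ℕ} (hj : j ≤ cd.N₀) {s : ℕ} (hs : s < cd.S j)
    {y : Fin 4 → ℤ → ℝ} (hy : NodeI cd j s y) :
    NodeI cd j (s + 1) (stAt φ j y (cd.h j s)) ∧
      ∀ u ∈ Icc 0 (cd.h j s), cd.InBall j (stAt φ j y u - cd.TP j s u) (cd.SpI j s) := by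
  obtain ⟨e, hdec, he⟩ := hy
  have hV' := hV
  obtain ⟨-, hN, hC, -⟩ := hV'
  have hω : ∀ k, 0 < cd.ω j k := (hN.1 j hj).2.2.2.2.2.2.1
  obtain ⟨-, -, -, -, -, -, hA, hB⟩ := hC j hj
  obtain ⟨-, -, -, -, a5, a6, a7, a8, a9, -, -, a12, -, -, -, -, a17, a18, a19, a20⟩ := hA s hs.le
  obtain ⟨-, -, -, -, -, -, -, -, -, -, -, a12', a13', -⟩ := hA (s + 1) hs
  obtain ⟨-, -, -, -, -, -, -, -, -, -, -, -, -, b14, -, -, b17, -⟩ := hB s hs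
  have hCm0 : cd.Cm j s 0 = 0 := a12.map_zero
  have hPj : ∀ n, n ≤ cd.pdeg → toVec cd (cd.P j s n) = taylorJet (Qw cd) (toVec cd (cd.x j s)) n :=
    toVec_table_eq_taylorJet a17 a18
  have hξ : ∀ i k, -cd.Kb ≤ k → k ≤ cd.Ka → |(0 : Fin 4 → ℤ → ℝ) i k| ≤ cd.rP j s i k := fun i k _ _ => by
    simp only [Pi.zero_apply, abs_zero]; exact a5 i k
  have hyd : ∀ i k, -cd.Kb ≤ k → k ≤ cd.Ka → y i k = cd.x j s i k + cd.Cm j s 0 i k + e i k := fun i k h1 h2 => by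
    simp only [hCm0, Pi.zero_apply, add_zero]; exact hdec i k h1 h2
  have hf : (0 : ℝ) ≤ 0 := le_rfl
  have hε : 0 ≤ cd.EI j s := a6
  have hEρ : cd.EI j s ≤ cd.ρO j s := a7.trans (a8.trans a9)
  have hfe : 0 + cd.EI j s ≤ cd.ρO j s := by rw [zero_add]; exact hEρ
  have hCmξ : cd.InBall j (cd.Cm j s 0) 0 := by rw [hCm0]; exact inBall_zero j
  refine ⟨?_, fun u hu => ?_⟩
  · obtain ⟨-, he'⟩ := node_step hF hV hj hs hf hε hfe hξ hCmξ he hyd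
    rw [hCm0, Vap_zero a19 a20 hPj, a13'.map_zero, a12'.map_zero, sub_zero, zero_add] at he'
    refine ⟨stAt φ j y (cd.h j s) - cd.x j (s + 1), fun i k _ _ => ?_, inBall_mono hω he' b17⟩
    simp only [Pi.sub_apply]
    ring
  · have h1 := inStep_bound hF hV hj hs hf hε hfe hCmξ he hyd hu
    rw [zero_add] at h1
    exact inBall_mono hω h1 ((inStep_radius_le hV hj hs hε hEρ hu).trans b14)

end Summit.NavierStokesRegularity.NavierStokesRegularity.Theorems.TaylorModelReadout

end
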